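import Literature.NumberTheory.PAdicHodge.AinfRamifiedTorsionLiftAdd
import Literature.NumberTheory.PAdicHodge.AinfRamifiedOmegaPeriod
import Literature.NumberTheory.PAdicHodge.AinfWeierstrassTateModuleIntegers
import HarnessLib

/-!
# `T_pŴ(𝒪_{ℂ_F})` for a Weierstrass equation over the ramified base `𝒪_D = ℤ_p[ϖ]`: the coordinate sequences of the Tate
# module `TatePtO` and their dictionary with the `A_inf(𝒪)`-side operations `[p]_W`, `⊕_W`, `σ`

Topic `Literature/NumberTheory/PAdicHodge`. The ramified twin of `AinfWeierstrassTateModule` §2 (case `W/ℤ`). The period maps over the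
ramified Fontaine ring `A_inf(𝒪) = 𝔸_inf(F)[ϖ]` (`AinfRamifiedTorsionLift`, `AinfRamifiedOmegaPeriod`, `AinfRamifiedTorsionLiftAdd`, …)
are functions of `[p]`-compatible sequences `t : ℕ → 𝔪_{ℂ_F}` of torsion points of the formal group of `W : WeierstrassCurve (CoeffDisc D)`
(`CoeffDisc D` = the discrete copy of `𝒪_D = ℤ_p[X]/(f)`), while the Tate module on which `Γ_F` acts `ℤ_p`-linearly and which is matched
with `T_p E(F̄)` (`AinfWeierstrassTateModuleIntegers(SS)`, `AinfWeierstrassTateModuleGeomO`) is `TatePtO F W♭ p = T_pŴ♭(𝒪_{ℂ_F})` for a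
Weierstrass equation `W♭` over the discrete copy `LTCoeff F` of `𝒪_F`. This file is the dictionary between the two, for `W♭ = W.map ψ`
along ANY ring map `ψ : 𝒪_D → 𝒪_F` compatible with `𝒪_D → F` (e.g. the bridge of `EisensteinRoot.exists_coeffToLTCoeff`):

* §0 (generic) **change of coefficient ring in the evaluation of formal power series at points of a nil ideal**:
  `evalPt M (f.map φ) x = evalPt M f x` whenever `algebraMap ∘ φ = algebraMap` (`LubinTate.evalPt_map_of_algebraMap_eq`, `evalPt₁_…`).
* §1 `AinfTop.seqO W♭ τ n = (τ_n : 𝔪_{ℂ_F})`, the coordinate sequence of `τ ∈ TatePtO F W♭ p` (any `W♭` over `LTCoeff F`): `seqO_zero`,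
  `evalPt₁_formalMul_seqO` (`[p] τ_{n+1} = τ_n`), `seqO_add` (termwise `⊕`), `seqO_smul` (`= galSeq`), `seqO_injective`, `ofSeqO`.
* §2 for `W` over `CoeffDisc D` and `ψ` as above: `algebraMap_ψ_eq` (`𝒪_D → 𝒪_F → 𝒪_{ℂ_F}` is `𝒪_D → 𝒪_{ℂ_F}`), `curveFO_map_ψ`
  (`(W ⊗_ψ 𝒪_F) ⊗ F = W ⊗ F` along `CoeffDisc.toF`), **`val_p_nsmul_map_ψ : (p • P).val = mulPC W P.val`**,
  **`val_add_map_ψ : (P + Q).val = addWC W P.val Q.val`** on `Ŵ♭(𝔪_{ℂ_F})`, hence **`mulPC_seqO : mulPC W (τ_{n+1}) = τ_n`**,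
  **`seqO_add_eq_addSeq : seqO (τ + τ') = addSeq W (seqO τ) (seqO τ')`**, and Fontaine's element / the ω-period read on `TatePtO`:
  `torsionLiftO`, `omegaPeriodO` with `theta_torsionLiftO`, `gal_torsionLiftO`, `omegaPeriodO_mem_filOne`, `gal_omegaPeriodO`
  (`σ(∫_τ ω) = ∫_{σ τ} ω`), `torsionLiftO_add` (`[τ + τ'] = [τ] ⊕_W [τ']`).

What is NOT here: additivity of `∫ω` on `TatePtO` (needs `omegaPeriod_addSeq` over `A_inf(𝒪)`, file `AinfRamifiedOmegaPeriodAdd`), the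
η-period, `ℤ_p`-linearity, the socket. BSD context: route EdixhovenFibreFiveSeven, crux K★ `stmt-BirchSwinnertonDyer-22226`, road (R1)
(memo `Cruxes/StarredOptimalManinUnitFiveSeven/Lines/kato-lever-hDR-R1-models-descent.md` §6). BSD / K★ are not proved by any of this.

## References
* J.-M. Fontaine, *Le corps des périodes p-adiques*, Astérisque 223 (1994), Exp. II §1.2. [FontaineAsterisque223III]
* J. H. Silverman, *The Arithmetic of Elliptic Curves* (2009), III.§7, IV.2.3. [SilvermanAEC2009]
* J. W. S. Cassels, A. Fröhlich (eds.), *Algebraic Number Theory* (1967), Ch. VI §3.2. [CasselsFrohlichANT1967]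
-/

noncomputable section

open Ideal Filter Topology Field WittVector MvPowerSeries ValuativeRel

/-! ## §0 Change of coefficient ring in the evaluation at points of a nil ideal -/

namespace Literature.NumberTheory.GaloisRepresentations.LubinTate

variable {A : Type*} [CommRing A] [UniformSpace A] [DiscreteUniformity A]
  {B : Type*} [CommRing B] [UniformSpace B] [DiscreteUniformity B]
  {S : Type*} [CommRing S] [UniformSpace S] [IsUniformAddGroup S] [IsTopologicalRing S]
  [IsLinearTopology S S] [T2Space S] [CompleteSpace S] [Algebra A S] [ContinuousSMul A S] [Algebra B S] [ContinuousSMul B S]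
  (φ : A →+* B) (hφ : ∀ a, algebraMap B S (φ a) = algebraMap A S a)

include hφ in
/-- **Change of coefficients in the evaluation**: if `φ : A → B` is compatible with the structure maps to `S`, then evaluating
`φ_* f` at a topologically nilpotent family is evaluating `f` (both are `Σ_d c_d · x^d`). [cite: CasselsFrohlichANT1967, Ch. VI §3.2] -/
theorem aeval_map_of_algebraMap_eq {ι : Type*} {x : ι → S} (hx : HasEval x) (f : MvPowerSeries ι A) :
    MvPowerSeries.aeval hx (MvPowerSeries.map φ f) = MvPowerSeries.aeval hx f := by
  have h1 := MvPowerSeries.hasSum_aeval hx (MvPowerSeries.map φ f)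
  have h2 := MvPowerSeries.hasSum_aeval hx f
  simp_rw [MvPowerSeries.coeff_map, Algebra.smul_def, hφ] at h1
  simp_rw [Algebra.smul_def] at h2
  exact h1.unique h2

include hφ in
/-- **Change of coefficients in `evalPt`**: `evalPt M (φ_* f) x = evalPt M f x`. [cite: CasselsFrohlichANT1967, Ch. VI §3.2] -/
theorem evalPt_map_of_algebraMap_eq (M : NilIdeal S) {ι : Type*} [Finite ι] (f : MvPowerSeries ι A) (hf : f.constantCoeff = 0)
    (hf' : (MvPowerSeries.map φ f).constantCoeff = 0) (x : ι → M.toIdeal) :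
    evalPt M (MvPowerSeries.map φ f) hf' x = evalPt M f hf x :=
  Subtype.ext (aeval_map_of_algebraMap_eq φ hφ (M.hasEval x) f)

include hφ in
/-- **Change of coefficients in `evalPt₁`**: `(φ_* h)(x) = h(x)`. [cite: CasselsFrohlichANT1967, Ch. VI §3.2] -/
theorem evalPt₁_map_of_algebraMap_eq (M : NilIdeal S) (h : PowerSeries A) (hh : PowerSeries.constantCoeff h = 0)
    (hh' : PowerSeries.constantCoeff (PowerSeries.map φ h) = 0) (x : M.toIdeal) :
    evalPt₁ M (PowerSeries.map φ h) hh' x = evalPt₁ M h hh x :=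
  evalPt_map_of_algebraMap_eq φ hφ M (ι := Unit) h hh hh' fun _ => x

include hφ in
/-- **Change of coefficients in the formal-group addition of a Weierstrass equation**: `⊕_{W ⊗_φ B} = ⊕_W` on `M`.
[cite: SilvermanAEC2009, IV.2.2] [cite: CasselsFrohlichANT1967, Ch. VI §3.2] -/
theorem addPt_toFormalGroup_map_of_algebraMap_eq (M : NilIdeal S) (W : WeierstrassCurve A) (x y : M.toIdeal) :
    addPt M (W.map φ).toFormalGroup x y = addPt M W.toFormalGroup x y := by
  rw [addPt, addPt]
  have hlaw : (W.map φ).toFormalGroup.toPowerSeries = MvPowerSeries.map φ W.toFormalGroup.toPowerSeries := by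
    rw [WeierstrassCurve.toFormalGroup_map]; rfl
  rw [evalPt_congr M hlaw _ (by rw [← hlaw]; exact (W.map φ).toFormalGroup.zero_constantCoeff)]
  exact evalPt_map_of_algebraMap_eq φ hφ M _ _ _ _

end Literature.NumberTheory.GaloisRepresentations.LubinTate

namespace Literature.NumberTheory.PAdicHodge

open Literature.NumberTheory.GaloisRepresentations
open Literature.NumberTheory.GaloisRepresentations.IsNonarchimedeanLocalField
open Literature.NumberTheory.GaloisRepresentations.LubinTate
open Literature.NumberTheory.EllipticCurves

/-! ## §1 The coordinate sequences of `TatePtO F W♭ p` (`W♭` over `LTCoeff F`) -/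

namespace AinfTop

variable {F : Type} [Field F] [ValuativeRel F] [TopologicalSpace F] [IsNonarchimedeanLocalField F]
  (W : WeierstrassCurve (LTCoeff F)) {p : ℕ}

/-- The coordinate sequence `(τ_n)_n ⊂ 𝔪_{ℂ_F}` of `τ ∈ T_pŴ(𝒪_{ℂ_F})`, `W` over `𝒪_F`. [cite: SilvermanAEC2009, III.§7] -/
def seqO (τ : TatePtO F W p) (n : ℕ) : (maxNilIdealC F).toIdeal := (TateModule.proj p n τ).val

/-- Unfolding `seqO`. [cite: SilvermanAEC2009, III.§7] -/
theorem seqO_apply (τ : TatePtO F W p) (n : ℕ) : seqO W τ n = (TateModule.proj p n τ).val := rfl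

/-- `τ₀ = 0` (the level-`0` component is killed by `p⁰ = 1`). [cite: SilvermanAEC2009, III.§7] -/
theorem seqO_zero (τ : TatePtO F W p) : (seqO W τ 0 : CBall F) = 0 := by
  have h := TateModule.pow_smul_proj 0 τ
  rw [pow_zero, one_smul] at h
  rw [seqO_apply, h, WeierstrassCurve.Pt.val_zero]
  rfl

/-- **`p • P = [p]_W(P)`** in `Ŵ(𝔪_{ℂ_F})`, `W` over `𝒪_F`. [cite: SilvermanAEC2009, IV.2.3] -/
theorem val_p_nsmul_O (P : W.Pt (maxNilIdealC F)) :
    (p • P).val = evalPt₁ (maxNilIdealC F) (W.formalMul p) (W.constantCoeff_formalMul p) P.val :=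
  WeierstrassCurve.Pt.val_nsmul p P

/-- `[p]_W τ_{n+1} = τ_n`. [cite: SilvermanAEC2009, III.§7] -/
theorem evalPt₁_formalMul_seqO (τ : TatePtO F W p) (n : ℕ) :
    evalPt₁ (maxNilIdealC F) (W.formalMul p) (W.constantCoeff_formalMul p) (seqO W τ (n + 1)) = seqO W τ n := by
  rw [seqO_apply, seqO_apply, ← val_p_nsmul_O, TateModule.smul_proj_succ]

/-- **Addition**: `seqO (τ + τ')_n = τ_n ⊕_W τ'_n`. [cite: SilvermanAEC2009, III.§7] -/
theorem seqO_add (τ τ' : TatePtO F W p) (n : ℕ) :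
    seqO W (τ + τ') n = addPt (maxNilIdealC F) W.toFormalGroup (seqO W τ n) (seqO W τ' n) := rfl

/-- **Galois**: `seqO (σ • τ) = σ ∘ seqO τ` (`galSeq`). [cite: FontaineAsterisque223III, Exp. II §1.2] -/
theorem seqO_smul (σ : absoluteGaloisGroup F) (τ : TatePtO F W p) : seqO W (σ • τ) = galSeq F σ (seqO W τ) := rfl

/-- `seqO` is injective. [cite: SilvermanAEC2009, III.§7] -/
theorem seqO_injective : Function.Injective (seqO (F := F) (p := p) W) := fun _ _ h =>
  TateModule.ext fun n => WeierstrassCurve.Pt.ext (congrFun h n)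

/-- `pⁿ • t_n = 0` for a `[p]_W`-compatible sequence with `t₀ = 0`. [cite: SilvermanAEC2009, III.§7] -/
theorem pow_nsmul_eq_zero_of_seqO {t : ℕ → (maxNilIdealC F).toIdeal} (ht0 : (t 0 : CBall F) = 0)
    (htp : ∀ n, evalPt₁ (maxNilIdealC F) (W.formalMul p) (W.constantCoeff_formalMul p) (t (n + 1)) = t n) (n : ℕ) :
    p ^ n • (⟨t n⟩ : W.Pt (maxNilIdealC F)) = 0 := by
  induction n with
  | zero => rw [pow_zero, one_smul]; exact WeierstrassCurve.Pt.ext (Subtype.ext ht0)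
  | succ n ih =>
    have h : p • (⟨t (n + 1)⟩ : W.Pt (maxNilIdealC F)) = ⟨t n⟩ :=
      WeierstrassCurve.Pt.ext ((val_p_nsmul_O W _).trans (htp n))
    rw [pow_succ, mul_nsmul', h, ih]

/-- **The bridge**: a `[p]_W`-compatible sequence of points of `Ŵ(𝔪_{ℂ_F})` with `t₀ = 0` IS an element of `T_pŴ(𝒪_{ℂ_F})`.
[cite: SilvermanAEC2009, III.§7] -/
def ofSeqO (t : ℕ → (maxNilIdealC F).toIdeal) (ht0 : (t 0 : CBall F) = 0)
    (htp : ∀ n, evalPt₁ (maxNilIdealC F) (W.formalMul p) (W.constantCoeff_formalMul p) (t (n + 1)) = t n) : TatePtO F W p :=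
  TateModule.mk (fun n => (⟨t n⟩ : W.Pt (maxNilIdealC F))) (pow_nsmul_eq_zero_of_seqO W ht0 htp)
    fun n => WeierstrassCurve.Pt.ext ((val_p_nsmul_O W _).trans (htp n))

/-- `seqO (ofSeqO t) = t`. [cite: SilvermanAEC2009, III.§7] -/
@[simp] theorem seqO_ofSeqO (t : ℕ → (maxNilIdealC F).toIdeal) (ht0 : (t 0 : CBall F) = 0)
    (htp : ∀ n, evalPt₁ (maxNilIdealC F) (W.formalMul p) (W.constantCoeff_formalMul p) (t (n + 1)) = t n) :
    seqO W (ofSeqO W t ht0 htp) = t := rfl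

/-- `ofSeqO (seqO τ) = τ`. [cite: SilvermanAEC2009, III.§7] -/
@[simp] theorem ofSeqO_seqO (τ : TatePtO F W p) : ofSeqO W (seqO W τ) (seqO_zero W τ) (evalPt₁_formalMul_seqO W τ) = τ :=
  TateModule.ext fun _ => rfl

end AinfTop

/-! ## §2 `W` over `CoeffDisc D` read through `ψ : 𝒪_D → 𝒪_F` -/

namespace AinfRamTop

variable {F : Type} [Field F] [ValuativeRel F] [TopologicalSpace F] [IsNonarchimedeanLocalField F] [CharZero F]
  {p : ℕ} [Fact p.Prime] {hp : valuation F p < 1} {D : EisensteinRoot F p hp}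
  (W : WeierstrassCurve (EisensteinRoot.CoeffDisc D)) (ψ : EisensteinRoot.CoeffDisc D →+* LTCoeff F)
  (hψ : ∀ c, algebraMap (LTCoeff F) F (ψ c) = EisensteinRoot.CoeffDisc.toF D c)

include hψ in
/-- **`𝒪_D → 𝒪_F → 𝒪_{ℂ_F}` is `𝒪_D → 𝒪_{ℂ_F}`** for a bridge `ψ` compatible with `𝒪_D → F`. [cite: SilvermanAEC2009, VII.§1] -/
theorem algebraMap_ψ_eq (c : EisensteinRoot.CoeffDisc D) :
    algebraMap (LTCoeff F) (CBall F) (ψ c) = algebraMap (EisensteinRoot.CoeffDisc D) (CBall F) c := by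
  apply Subtype.ext
  rw [AinfTop.coe_algebraMap_ltCoeff]
  change algebraMap F (CompletedAlgClosure F) (algebraMap (LTCoeff F) F (ψ c)) =
    ((algebraMap (EisensteinRoot.CoeffDisc D) (CBall F)
      (EisensteinRoot.CoeffDisc.of D ((EisensteinRoot.CoeffDisc.of D).symm c)) : CBall F) : CompletedAlgClosure F)
  rw [hψ, EisensteinRoot.coe_algebraMap_coeffDisc_cBall]
  rfl

include hψ in
/-- **`(W ⊗_ψ 𝒪_F) ⊗ F = W ⊗_{𝒪_D} F`** (`curveFO (W.map ψ) = W.map CoeffDisc.toF`). [cite: SilvermanAEC2009, VII.§1] -/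
theorem map_ψ_map_algebraMap : (W.map ψ).map (algebraMap (LTCoeff F) F) = W.map (EisensteinRoot.CoeffDisc.toF D) := by
  rw [WeierstrassCurve.map_map]
  exact congrArg W.map (RingHom.ext fun c => hψ c)

include hψ in
/-- **`p • P = [p]_W(P)` on `Ŵ♭(𝔪_{ℂ_F})`, `W♭ = W ⊗_ψ 𝒪_F`, with `[p]_W` evaluated from the `𝒪_D`-coefficients** (`mulPC W`).
[cite: SilvermanAEC2009, IV.2.3] -/
theorem val_p_nsmul_map_ψ (P : (W.map ψ).Pt (maxNilIdealC F)) : (p • P).val = mulPC W P.val := by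
  rw [AinfTop.val_p_nsmul_O, mulPC]
  have key : ∀ {f : PowerSeries (LTCoeff F)} (hf : PowerSeries.constantCoeff f = 0),
      f = PowerSeries.map ψ (W.formalMul p) →
      evalPt₁ (maxNilIdealC F) f hf P.val = evalPt₁ (maxNilIdealC F) (W.formalMul p) (W.constantCoeff_formalMul p) P.val := by
    rintro f hf rfl
    exact evalPt₁_map_of_algebraMap_eq ψ (algebraMap_ψ_eq ψ hψ) _ _ _ _ _
  exact key _ (W.map_formalMul ψ p).symm

include hψ in
/-- **`(P + Q).val = P.val ⊕_W Q.val` on `Ŵ♭(𝔪_{ℂ_F})` with `⊕_W` evaluated from the `𝒪_D`-coefficients** (`addWC W`).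
[cite: SilvermanAEC2009, IV.2.2] -/
theorem val_add_map_ψ (P Q : (W.map ψ).Pt (maxNilIdealC F)) : (P + Q).val = addWC W P.val Q.val := by
  rw [WeierstrassCurve.Pt.val_add, addPt_toFormalGroup_map_of_algebraMap_eq ψ (algebraMap_ψ_eq ψ hψ)]
  rfl

include hψ in
/-- **`[p]_W τ_{n+1} = τ_n`** for `τ ∈ TatePtO F (W ⊗_ψ 𝒪_F) p`, with `[p]_W = mulPC W` (the compatibility hypothesis `htp` of the
`A_inf(𝒪)`-side constructions `torsionLift`, `omegaPeriod`, …). [cite: SilvermanAEC2009, III.§7] -/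
theorem mulPC_seqO (τ : AinfTop.TatePtO F (W.map ψ) p) (n : ℕ) :
    mulPC W (AinfTop.seqO (W.map ψ) τ (n + 1)) = AinfTop.seqO (W.map ψ) τ n := by
  rw [AinfTop.seqO_apply, AinfTop.seqO_apply, ← val_p_nsmul_map_ψ W ψ hψ, TateModule.smul_proj_succ]

include hψ in
/-- **`seqO (τ + τ') = addSeq W (seqO τ) (seqO τ')`** (termwise `⊕_W` from the `𝒪_D`-coefficients). [cite: SilvermanAEC2009, III.§7] -/
theorem seqO_add_eq_addSeq (τ τ' : AinfTop.TatePtO F (W.map ψ) p) :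
    AinfTop.seqO (W.map ψ) (τ + τ') = addSeq W (AinfTop.seqO (W.map ψ) τ) (AinfTop.seqO (W.map ψ) τ') := by
  funext n
  rw [AinfTop.seqO_apply, addSeq, AinfTop.seqO_apply, AinfTop.seqO_apply, map_add, val_add_map_ψ W ψ hψ]

include hψ in
/-- A `mulPC W`-compatible sequence with `t₀ = 0` as an element of `TatePtO F (W ⊗_ψ 𝒪_F) p`. [cite: SilvermanAEC2009, III.§7] -/
theorem exists_seqO_eq {t : ℕ → (maxNilIdealC F).toIdeal} (ht0 : (t 0 : CBall F) = 0) (htp : ∀ n, mulPC W (t (n + 1)) = t n) :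
    ∃ τ : AinfTop.TatePtO F (W.map ψ) p, AinfTop.seqO (W.map ψ) τ = t := by
  have htp' : ∀ n, evalPt₁ (maxNilIdealC F) ((W.map ψ).formalMul p) ((W.map ψ).constantCoeff_formalMul p) (t (n + 1)) = t n :=
    fun n => by
      have h := val_p_nsmul_map_ψ W ψ hψ (⟨t (n + 1)⟩ : (W.map ψ).Pt (maxNilIdealC F))
      rw [AinfTop.val_p_nsmul_O] at h
      exact h.trans (htp n)
  exact ⟨AinfTop.ofSeqO (W.map ψ) t ht0 htp', rfl⟩

/-! ### Fontaine's element and the ω-period read on `TatePtO` -/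

variable [Fact (¬ IsUnit (p : integerC F))] [IsAdicComplete (Ideal.span {(p : integerC F)}) (integerC F)]
  {hθ : Function.Surjective (fontaineTheta (integerC F) p)}

/-- **Fontaine's element `[τ] ∈ ker θ_𝒪 ⊂ A_inf(𝒪)` of `τ ∈ T_pŴ♭(𝒪_{ℂ_F})`**, `W♭ = W ⊗_ψ 𝒪_F`.
[cite: FontaineAsterisque223III, Exp. II §1.2.2] -/
def torsionLiftO (hθ : Function.Surjective (fontaineTheta (integerC F) p))
    (hψ : ∀ c, algebraMap (LTCoeff F) F (ψ c) = EisensteinRoot.CoeffDisc.toF D c) (τ : AinfTop.TatePtO F (W.map ψ) p) :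
    AinfRamTop D :=
  torsionLift W hθ (AinfTop.seqO (W.map ψ) τ) (mulPC_seqO W ψ hψ τ)

/-- Unfolding `torsionLiftO`. [cite: FontaineAsterisque223III, Exp. II §1.2.2] -/
theorem torsionLiftO_def (τ : AinfTop.TatePtO F (W.map ψ) p) :
    torsionLiftO W ψ hθ hψ τ = torsionLift W hθ (AinfTop.seqO (W.map ψ) τ) (mulPC_seqO W ψ hψ τ) := rfl

/-- Congruence for `torsionLift` in the sequence. [cite: FontaineAsterisque223III, Exp. II §1.2.2] -/
theorem torsionLift_congr_seq {t t' : ℕ → (maxNilIdealC F).toIdeal} (h : t = t')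
    (htp : ∀ n, mulPC W (t (n + 1)) = t n) (htp' : ∀ n, mulPC W (t' (n + 1)) = t' n) :
    torsionLift W hθ t htp = torsionLift W hθ t' htp' := by subst h; rfl

/-- Congruence for `omegaPeriod` in the sequence. [cite: Fontaine1982FormesDifferentielles, §5] -/
theorem omegaPeriod_congr_seq {t t' : ℕ → (maxNilIdealC F).toIdeal} (h : t = t')
    (ht0 : (t 0 : CBall F) = 0) (htp : ∀ n, mulPC W (t (n + 1)) = t n)
    (ht0' : (t' 0 : CBall F) = 0) (htp' : ∀ n, mulPC W (t' (n + 1)) = t' n) :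
    omegaPeriod W hθ t ht0 htp = omegaPeriod W hθ t' ht0' htp' := by subst h; rfl

/-- `[τ] ∈ 𝔫_𝒪`. [cite: FontaineAsterisque223III, Exp. II §1.2.2] -/
theorem torsionLiftO_mem_nilTheta (τ : AinfTop.TatePtO F (W.map ψ) p) : torsionLiftO W ψ hθ hψ τ ∈ (nilTheta D hθ).toIdeal :=
  flim_mem_nilTheta (isContracting_mulP (hθ := hθ) W) (mulP_lift_sub_mem W (mulPC_seqO W ψ hψ τ) (theta_lift _))

/-- `θ_𝒪([τ]) = 0`. [cite: FontaineAsterisque223III, Exp. II §1.2.2] -/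
theorem theta_torsionLiftO (τ : AinfTop.TatePtO F (W.map ψ) p) : theta D (torsionLiftO W ψ hθ hψ τ) = 0 :=
  theta_torsionLift W (AinfTop.seqO_zero _ τ) (mulPC_seqO W ψ hψ τ)

/-- **`Γ_F`-equivariance `σ[τ] = [σ • τ]`.** [cite: FontaineAsterisque223III, Exp. II §1.2] -/
theorem gal_torsionLiftO (σ : absoluteGaloisGroup F) (τ : AinfTop.TatePtO F (W.map ψ) p) :
    gal D σ (torsionLiftO W ψ hθ hψ τ) = torsionLiftO W ψ hθ hψ (σ • τ) := by
  rw [torsionLiftO_def, torsionLiftO_def, gal_torsionLift W σ (mulPC_seqO W ψ hψ τ)]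
  exact torsionLift_congr_seq W (AinfTop.seqO_smul _ σ τ).symm _ _

/-- **Additivity `[τ + τ'] = [τ] ⊕_W [τ']` in `Ŵ(𝔫_𝒪)`** (from `torsionLift_addSeq`). [cite: FontaineAsterisque223III, Exp. II §1.2.2]
[cite: SilvermanAEC2009, IV.2.3] -/
theorem torsionLiftO_add (τ τ' : AinfTop.TatePtO F (W.map ψ) p) :
    torsionLiftO W ψ hθ hψ (τ + τ') =
      (addW W ⟨torsionLiftO W ψ hθ hψ τ, torsionLiftO_mem_nilTheta W ψ hψ τ⟩
        ⟨torsionLiftO W ψ hθ hψ τ', torsionLiftO_mem_nilTheta W ψ hψ τ'⟩ : AinfRamTop D) := by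
  rw [torsionLiftO_def, torsionLift_congr_seq W (seqO_add_eq_addSeq W ψ hψ τ τ') _
    (mulPC_addSeq W (mulPC_seqO W ψ hψ τ) (mulPC_seqO W ψ hψ τ'))]
  exact torsionLift_addSeq W (hθ := hθ) (mulPC_seqO W ψ hψ τ) (mulPC_seqO W ψ hψ τ')

/-- **The ω-period `∫_τ ω = log_W(ι_𝒪[τ]) ∈ B_dR⁺(F)` of `τ ∈ T_pŴ♭(𝒪_{ℂ_F})`.** [cite: Fontaine1982FormesDifferentielles, §5] -/
def omegaPeriodO (hθ : Function.Surjective (fontaineTheta (integerC F) p))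
    (hψ : ∀ c, algebraMap (LTCoeff F) F (ψ c) = EisensteinRoot.CoeffDisc.toF D c) (τ : AinfTop.TatePtO F (W.map ψ) p) :
    BdRPlusTop F p :=
  omegaPeriod W hθ (AinfTop.seqO (W.map ψ) τ) (AinfTop.seqO_zero _ τ) (mulPC_seqO W ψ hψ τ)

/-- Unfolding `omegaPeriodO`. [cite: Fontaine1982FormesDifferentielles, §5] -/
theorem omegaPeriodO_def (τ : AinfTop.TatePtO F (W.map ψ) p) :
    omegaPeriodO W ψ hθ hψ τ = omegaPeriod W hθ (AinfTop.seqO (W.map ψ) τ) (AinfTop.seqO_zero _ τ) (mulPC_seqO W ψ hψ τ) := rfl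

/-- **`∫_τ ω ∈ Fil¹ B_dR⁺`.** [cite: Fontaine1982FormesDifferentielles, §5] -/
theorem omegaPeriodO_mem_filOne (τ : AinfTop.TatePtO F (W.map ψ) p) :
    omegaPeriodO W ψ hθ hψ τ ∈ (BdRPlusTop.filOne F p).toIdeal :=
  omegaPeriod_mem_filOne W (AinfTop.seqO_zero _ τ) (mulPC_seqO W ψ hψ τ)

/-- **`Γ_F`-equivariance of the ω-period: `σ(∫_τ ω) = ∫_{σ • τ} ω`.** [cite: Fontaine1982FormesDifferentielles, §5]
[cite: FontaineAsterisque223III, Exp. II §1.5.4] -/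
theorem gal_omegaPeriodO (σ : absoluteGaloisGroup F) (τ : AinfTop.TatePtO F (W.map ψ) p) :
    BdRPlusTop.gal F p σ (omegaPeriodO W ψ hθ hψ τ) = omegaPeriodO W ψ hθ hψ (σ • τ) := by
  rw [omegaPeriodO_def, omegaPeriodO_def, gal_omegaPeriod W σ (AinfTop.seqO_zero _ τ) (mulPC_seqO W ψ hψ τ)]
  exact omegaPeriod_congr_seq W (AinfTop.seqO_smul _ σ τ).symm _ _ _ _

/-- `θ_dR(∫_τ ω) = 0`. [cite: Fontaine1982FormesDifferentielles, §5] -/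
theorem thetaBdR_omegaPeriodO (τ : AinfTop.TatePtO F (W.map ψ) p) :
    thetaBdR ((BdRPlusTop.of F p).symm (omegaPeriodO W ψ hθ hψ τ)) = 0 :=
  thetaBdR_omegaPeriod W (AinfTop.seqO_zero _ τ) (mulPC_seqO W ψ hψ τ)

end AinfRamTop

end Literature.NumberTheory.PAdicHodge

end
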